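import Mathlib.GroupTheory.FreeGroup.CyclicallyReduced
import Mathlib.Data.List.Rotate
import Literature.MathematicalPhysics.QuantumLattice.LatticeGaugeDLR
import HarnessLib

/-!
# Chatterjee's lattice string theory: paths, loops, non-backtracking cores, loop operations, trajectories and weights

S. Chatterjee, *Rigorous solution of strongly coupled `SO(N)` lattice gauge theory in the large `N`
limit*, Comm. Math. Phys. **366** (2019) 203–268 (arXiv:1502.07719), **§2 «Notation,
terminology and a lattice string theory»** (§2.1 loops and loop sequences, §2.2 a lattice string
theory) — DEFINITIONS ONLY (the objects in which the main theorem, Theorem 3.1, and the finite-`N`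
master loop equation, Theorem 3.6, are stated; those statements are the sibling module
`Chatterjee2019LargeN.StrongCoupling`). Typed for the cross-ladder literature-typing layer
(R141 (D), item (3)); no theorem of the source is asserted here and no named fact is introduced.

## Dictionary (source ↔ this file), all for the lattice `ℤ^d`, `d ≥ 2` (`Site d = Fin d → ℤ`)

* directed nearest-neighbour edges `E = E⁺ ∪ E⁻`, `u(e)`, `v(e)`, `e⁻¹` (§2 ¶1) ↔ `DEdge d :=
  ZdEdge d × Bool`: `(⟨x, i⟩, true)` is the positively oriented edge `x → x + eᵢ` (its end point is
  lexicographically larger), `(⟨x, i⟩, false)` its inverse; `DEdge.src`, `DEdge.tgt`, `DEdge.inv`.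
  This is the alphabet of Mathlib's free group `FreeGroup (ZdEdge d)` (words `List (α × Bool)`),
  and the tree's `Literature.MathematicalPhysics.QuantumLattice.dartStep` produces exactly such
  pairs from darts of `zdGraph d`.
* paths `ρ = e₁ e₂ ⋯ eₙ` with `v(eᵢ) = u(eᵢ₊₁)`, the null path, closed paths, `ρ⁻¹`, concatenation,
  length `|ρ|` (§2.1) ↔ words `Word d := List (DEdge d)` with the predicates `IsPath`,
  `IsClosedPath`; `ρ⁻¹ = FreeGroup.invRev ρ`, concatenation `++`, length `List.length`.
* cyclic equivalence of closed paths (§2.1) ↔ Mathlib `List.IsRotated` (`~r`); cycles are its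
  classes. Chatterjee then FIXES «the first edge of a cycle by some arbitrary rule» and «forget[s]
  about the distinction» between a cycle and the closed path representing it (§2.1); accordingly
  this file works throughout with REPRESENTING closed words (based loops), locations being indices
  `Fin ρ.length`, and every construction below is invariant under, or equivariant for, rotation of
  its inputs (flag F1).
* backtracks `eᵢ₊₁ = eᵢ⁻¹` (interior) and `e₁ = eₙ⁻¹` (terminal), backtrack erasure,
  nonbacktracking closed paths (§2.1) ↔ Mathlib: an interior backtrack erasure is a free-group
  reduction step `FreeGroup.Red.Step`, «no interior backtrack» is `FreeGroup.IsReduced`, «no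
  backtrack at all» is `FreeGroup.IsCyclicallyReduced`; **loops** = nonbacktracking cycles ↔
  `IsLoop ρ :↔ IsClosedPath ρ ∧ FreeGroup.IsCyclicallyReduced ρ` (on representatives); the null
  loop is `[]`.
* the **nonbacktracking core** `[ρ]` (§2.1, well defined up to cyclic equivalence by Lemma 2.1)
  ↔ `core ρ := FreeGroup.reduceCyclically (FreeGroup.reduce ρ)`: erase all interior backtracks
  (`reduce`), then all terminal ones (`reduceCyclically` strips first/last inverse pairs) — one
  particular maximal erasure sequence, hence a representative of `[ρ]` by Lemma 2.1 (flag F2).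
* plaquettes = nonbacktracking closed paths of length four; positively oriented plaquettes `𝒫⁺`
  (`u(e₁)` the lex-smallest vertex, `v(e₁)` the second smallest), `𝒫⁺(e)` (§2.1–2.2) ↔ the tree's
  `ZdPlaquette d` (base point = lex-smallest corner `x`, plane `i < j`), `plaquetteWord p`
  (`x → x+eⱼ → x+eᵢ+eⱼ → x+eᵢ → x`: the second-smallest corner of `p` is `x + eⱼ` for the LARGER
  index `j`), and the tree's `plaquettesTouching {e}` (plaquettes one of whose four edges is `e`).
* loop sequences, their minimal representations and length `|s|` (§2.1) ↔ `LoopSeq d := List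
  (Word d)` read as MINIMAL representations (no null component; `IsLoopSeq`), `LoopSeq.len`; the
  null loop sequence is `[]`; results of operations are re-minimised by deleting null loops
  (`LoopSeq.prune`).
* the string operations of §2.2 — positive/negative **merger** `l ⊕_{x,y} l'`, `l ⊖_{x,y} l'`,
  **deformation** `l ⊕ₓ p`, `l ⊖ₓ p` (`p ∈ 𝒫⁺(e)`), **splitting** `×¹_{x,y} l`, `×²_{x,y} l` and
  **twisting** `∝_{x,y} l` — ↔ `Word.posMerge`, `Word.negMerge`, `Word.posDeform`, `Word.negDeform`,
  `Word.posSplit₁/₂`, `Word.negSplit₁/₂`, `Word.posTwist`, `Word.negTwist` (formulas of §2.2 after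
  rotating the inputs so that the location `x` (resp. `y`) comes first, which the source's
  formulas permit since they are stated for cycles; see each docstring).
* the operation sets `𝔻^±(s)`, `𝕊^±(s)`, `𝕄^±(s)`, `𝕋^±(s)` of a loop sequence (§2.2, display
  before «In the above definitions, it is important to clarify how the operations are counted»)
  ↔ finite INDEX TYPES of operations `DeformIdx s`, `SameIdx s`, `InvIdx s`, `MergeIdx s` with
  result maps `LoopSeq.posDeformAt`, … (flag F3: operations are counted with multiplicity, as the
  source prescribes).
* **trajectories**, vanishing trajectories `𝒳(s)`, `𝒳ₖ(s)` (§2.2) ↔ the inductive family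
  `Trajectory s` of finite sequences of deformation/splitting moves (`Move s`) from `s` to the null
  loop sequence; `Trajectory.numDeform` (`δ(X)`).
* **weights** `w_β(s, s')`, `w_β(X)`, the `β`-free weights `v(s, s')`, `v(X)` (§2.2) ↔
  `Move.weight`, `Trajectory.weight`, `Move.vweight`, `Trajectory.vweight`.

## Faithfulness flags

* (F1) Representatives instead of cyclic classes: Chatterjee's loop is the rotation class
  (`List.IsRotated`) of any `ρ` with `IsLoop ρ`; his «location `k`» presupposes a chosen first
  edge («by some arbitrary rule»), i.e. a representative. Lengths, Wilson loop variables, areas and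
  weights are rotation invariant; the operation results below are computed after rotating the
  operands to the locations involved, so they do not depend on the representative at all; hence the
  index types and trajectory types built on representatives are in canonical bijection with the
  source's, with equal weights.
* (F2) `core` is ONE backtrack-erasure normal form; Lemma 2.1 (any two maximal erasure sequences
  from cyclically equivalent closed paths end in cyclically equivalent loops) is what makes the
  source's `[ρ]` a well-defined cycle. It is not restated as a fact (Mathlib's confluence of
  `FreeGroup.reduce` and `FreeGroup.reduceCyclically.conj_conjugator_reduceCyclically` are the
  ingredients of a proof).
* (F3) Multiplicity. §2.2: «it is important to clarify how the operations are counted … these two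
  splittings are identified as distinct elements of `𝕊⁺(s)` … the two operations mentioned above
  are counted as distinct elements of `𝕄⁺(s)`», and the recursion of §4 sums over locations and
  plaquettes. We therefore index operations by their DATA (component, location(s), plaquette /
  second component) and sum over these finite index types; a trajectory is a sequence of such
  moves. Where two data produce the same loop sequence they are counted twice, as in the source.
* (F4) Operations are defined on all words (total functions, junk on non-loops / out-of-range
  data); the statements of the sibling file only ever apply them to genuine loop sequences.
* (F5) `d ≥ 2` is assumed by the source throughout; nothing here needs it.

## References

* S. Chatterjee, Comm. Math. Phys. 366 (2019) 203–268, doi:10.1007/s00220-019-03353-3,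
  arXiv:1502.07719, §2 (pp. 5–7 of the arXiv version), Lemma 2.1. [Chatterjee2019LargeN]
-/

noncomputable section

open Literature.Probability.LatticeModels Literature.MathematicalPhysics.QuantumLattice

namespace Literature.MathematicalPhysics.QuantumFieldTheory.Chatterjee2019LargeN

variable {d : ℕ}

/-! ### §2 ¶1: directed edges of `ℤ^d` -/

/-- A directed nearest-neighbour edge of `ℤ^d`: `(⟨x, i⟩, true)` is the positively oriented edge
`x → x + eᵢ` (an element of `E⁺`; its end point is lexicographically larger than its beginning),
`(⟨x, i⟩, false)` is its inverse `x + eᵢ → x` (an element of `E⁻`). The letters of Mathlib's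
`FreeGroup (ZdEdge d)`. [cite: Chatterjee2019LargeN, §2 ¶1 (directed edges E, E⁺, E⁻, e⁻¹)] -/
abbrev DEdge (d : ℕ) : Type := ZdEdge d × Bool

namespace DEdge

/-- The beginning point `u(e)` of a directed edge. [cite: Chatterjee2019LargeN, §2 ¶1] -/
def src (e : DEdge d) : Literature.Probability.LatticeModels.Site d := if e.2 then e.1.1 else e.1.1 + Pi.single e.1.2 1

/-- The ending point `v(e)` of a directed edge. [cite: Chatterjee2019LargeN, §2 ¶1] -/
def tgt (e : DEdge d) : Literature.Probability.LatticeModels.Site d := if e.2 then e.1.1 + Pi.single e.1.2 1 else e.1.1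

/-- The inverse edge `e⁻¹ = (v, u)` of `e = (u, v)` (same undirected edge, opposite orientation).
[cite: Chatterjee2019LargeN, §2 ¶1] -/
def inv (e : DEdge d) : DEdge d := (e.1, !e.2)

/-- `src (e⁻¹) = tgt e`. [cite: Chatterjee2019LargeN, §2 ¶1] -/
theorem src_inv : ∀ e : DEdge d, src (inv e) = tgt e
  | (_, true) => rfl
  | (_, false) => rfl

/-- `tgt (e⁻¹) = src e`. [cite: Chatterjee2019LargeN, §2 ¶1] -/
theorem tgt_inv : ∀ e : DEdge d, tgt (inv e) = src e
  | (_, true) => rfl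
  | (_, false) => rfl

/-- `(e⁻¹)⁻¹ = e`. [cite: Chatterjee2019LargeN, §2 ¶1] -/
theorem inv_inv : ∀ e : DEdge d, inv (inv e) = e
  | (_, true) => rfl
  | (_, false) => rfl

end DEdge

/-! ### §2.1: paths, closed paths, cycles, backtracks, loops -/

/-- Edge words: finite sequences `e₁ e₂ ⋯ eₙ` of directed edges (the paths of §2.1 are the words
satisfying `IsPath`; the null path is `[]`). [cite: Chatterjee2019LargeN, §2.1 (paths)] -/
abbrev Word (d : ℕ) : Type := List (DEdge d)

/-- `ρ = e₁ ⋯ eₙ` is a **path**: `v(eᵢ) = u(eᵢ₊₁)` for `i = 1, …, n - 1` (the null word is a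
path). [cite: Chatterjee2019LargeN, §2.1 (definition of a path)] -/
def IsPath (ρ : Word d) : Prop := ρ.IsChain fun e f => DEdge.tgt e = DEdge.src f

/-- `ρ` is a **closed path**: a path with `v(eₙ) = u(e₁)`; «By definition, the null path is
closed». [cite: Chatterjee2019LargeN, §2.1 (closed paths, null path)] -/
def IsClosedPath (ρ : Word d) : Prop :=
  IsPath ρ ∧ ∀ h : ρ ≠ [], DEdge.tgt (ρ.getLast h) = DEdge.src (ρ.head h)

/-- The inverse path `ρ⁻¹ = eₙ⁻¹ eₙ₋₁⁻¹ ⋯ e₁⁻¹` is Mathlib's `FreeGroup.invRev` (reverse and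
invert every letter). [cite: Chatterjee2019LargeN, §2.1 (inverse of a path)] -/
theorem invRev_eq (ρ : Word d) : FreeGroup.invRev ρ = (ρ.map DEdge.inv).reverse := rfl

/-- `ρ` has a **backtrack at the interior location** `i` (`1 ≤ i ≤ n - 1` in the source's 1-based
count; here 0-based: letters `i` and `i + 1`): `eᵢ₊₁ = eᵢ⁻¹`.
[cite: Chatterjee2019LargeN, §2.1 (backtracks, interior backtrack)] -/
def HasInteriorBacktrack (ρ : Word d) (i : ℕ) : Prop :=
  ∃ h : i + 1 < ρ.length, ρ.get ⟨i + 1, h⟩ = DEdge.inv (ρ.get ⟨i, by omega⟩)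

/-- A closed path `ρ = e₁ ⋯ eₙ` has a **terminal backtrack** (a backtrack at location `n`):
`e₁ = eₙ⁻¹`. [cite: Chatterjee2019LargeN, §2.1 (terminal backtrack)] -/
def HasTerminalBacktrack (ρ : Word d) : Prop :=
  ∃ h : ρ ≠ [], ρ.head h = DEdge.inv (ρ.getLast h)

/-- «No interior backtrack» is Mathlib's `FreeGroup.IsReduced` (consecutive letters are never
inverse to each other), and a **nonbacktracking** closed path — no interior and no terminal
backtrack — is exactly a `FreeGroup.IsCyclicallyReduced` word; recorded as the definitional
dictionary entry. [cite: Chatterjee2019LargeN, §2.1 (nonbacktracking closed paths)] -/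
def IsNonbacktracking (ρ : Word d) : Prop := FreeGroup.IsCyclicallyReduced ρ

/-- A (based) **loop**: a nonbacktracking closed path. Chatterjee's loops are the cyclic
equivalence classes (`List.IsRotated`) of these; he fixes «the first edge of a cycle by some
arbitrary rule», i.e. a representative, which is what `ρ` is here (module docstring, flag F1). The
null loop is `[]` (`isLoop_nil`). [cite: Chatterjee2019LargeN, §2.1 (loops = nonbacktracking cycles; null loop)] -/
def IsLoop (ρ : Word d) : Prop := IsClosedPath ρ ∧ FreeGroup.IsCyclicallyReduced ρ

/-- The null path is a loop («The null cycle is by definition a loop»). [cite: Chatterjee2019LargeN, §2.1] -/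
theorem isLoop_nil : IsLoop ([] : Word d) :=
  ⟨⟨List.isChain_nil, fun h => (h rfl).elim⟩, FreeGroup.IsCyclicallyReduced.nil⟩

/-- The **nonbacktracking core** `[ρ]` of a closed path: erase interior backtracks until none is
left (`FreeGroup.reduce`, free reduction), then terminal ones (`FreeGroup.reduceCyclically`, which
strips matching first/last inverse pairs). By Lemma 2.1 of the source every maximal sequence of
backtrack erasures from a cyclically equivalent closed path ends in a cyclically equivalent loop, so
this normal form represents the source's cycle `[ρ]` (flag F2). [cite: Chatterjee2019LargeN, §2.1 (nonbacktracking core [l], Lemma 2.1)] -/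
def core (ρ : Word d) : Word d := FreeGroup.reduceCyclically (FreeGroup.reduce ρ)

/-- The core is a nonbacktracking word (Mathlib: `reduce` is reduced, `reduceCyclically` of a
reduced word is cyclically reduced). [cite: Chatterjee2019LargeN, §2.1 (the core is a loop)] -/
theorem isCyclicallyReduced_core (ρ : Word d) : FreeGroup.IsCyclicallyReduced (core ρ) :=
  FreeGroup.reduceCyclically.isCyclicallyReduced (FreeGroup.isReduced_iff_reduce_eq.2 FreeGroup.reduce.idem)

/-- The core of the null path is null. [cite: Chatterjee2019LargeN, §2.1] -/
theorem core_nil : core ([] : Word d) = [] :=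
  (congrArg FreeGroup.reduceCyclically FreeGroup.reduce_nil).trans FreeGroup.reduceCyclically.nil

/-! ### §2.1: plaquettes -/

/-- The positively oriented plaquette `p ∈ 𝒫⁺` based at `x` in the plane `i < j`
(`p = (x, ⟨(i, j), _⟩) : ZdPlaquette d`) as a closed edge word `e₁ e₂ e₃⁻¹ e₄⁻¹`: `u(e₁) = x` is
the lexicographically smallest corner and `v(e₁) = x + eⱼ` the second smallest (for `i < j` the
corner `x + eⱼ` precedes `x + eᵢ` lexicographically), so
`p = (x → x+eⱼ → x+eᵢ+eⱼ → x+eᵢ → x)` with `e₁ = (x, j)`, `e₂ = (x+eⱼ, i)`, `e₃ = (x+eᵢ, j)`,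
`e₄ = (x, i)` in `E⁺`. [cite: Chatterjee2019LargeN, §2.1 (positively oriented plaquettes 𝒫⁺), §3 (p = e₁e₂e₃⁻¹e₄⁻¹)] -/
def plaquetteWord (p : ZdPlaquette d) : Word d :=
  [((p.1, p.2.1.2), true), ((p.1 + Pi.single p.2.1.2 1, p.2.1.1), true),
    ((p.1 + Pi.single p.2.1.1 1, p.2.1.2), false), ((p.1, p.2.1.1), false)]

/-- A plaquette word has length four. [cite: Chatterjee2019LargeN, §2.1 («closed path of length four»)] -/
theorem length_plaquetteWord (p : ZdPlaquette d) : (plaquetteWord p).length = 4 := rfl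

/-- `𝒫⁺(e)`: the positively oriented plaquettes containing the undirected edge of `e` (i.e. `e` or
`e⁻¹`) — the tree's `plaquettesTouching {e}` (`2(d-1)` plaquettes).
[cite: Chatterjee2019LargeN, §2.2 (the set 𝒫⁺(e))] -/
def plaquettesAt (e : DEdge d) : Finset (ZdPlaquette d) := plaquettesTouching {e.1}

/-! ### §2.1: loop sequences -/

/-- Loop sequences in MINIMAL representation: finite sequences of loops with no null component
(the source's loop sequences are finite sequences of loops modulo inserting/deleting null loops;
each class has a unique minimal representation, §2.1). As a type we take all `List (Word d)`; the
predicate `IsLoopSeq` singles out the genuine minimal loop sequences. The null loop sequence is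
`[]`. [cite: Chatterjee2019LargeN, §2.1 (loop sequences, minimal representation)] -/
abbrev LoopSeq (d : ℕ) : Type := List (Word d)

/-- `s` is a genuine loop sequence in minimal representation: every component is a non-null loop.
[cite: Chatterjee2019LargeN, §2.1 (minimal representation)] -/
def IsLoopSeq (s : LoopSeq d) : Prop := ∀ l ∈ s, IsLoop l ∧ l ≠ []

namespace LoopSeq

/-- The length `|s| = |l₁| + ⋯ + |lₙ|` of a loop sequence (in minimal representation; the null loop
sequence has length `0`). [cite: Chatterjee2019LargeN, §2.1 (length of a loop sequence)] -/
def len (s : LoopSeq d) : ℕ := (s.map List.length).sum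

/-- Re-minimisation: delete null loops. [cite: Chatterjee2019LargeN, §2.1 (minimal representation)] -/
def prune (s : LoopSeq d) : LoopSeq d := s.filter fun l => l ≠ []

/-- Replace the `i`-th component of `s` by the list of words `ws` (in this order, at position `i`)
and re-minimise — the shape of the result of a deformation (`ws = [l']`), splitting
(`ws = [×¹ l, ×² l]`) or twisting of the component `lᵢ`. [cite: Chatterjee2019LargeN, §2.2 (operations on loop sequences)] -/
def replaceAt (s : LoopSeq d) (i : ℕ) (ws : List (Word d)) : LoopSeq d :=
  prune (s.take i ++ ws ++ s.drop (i + 1))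

/-- The null loop sequence has length `0`. [cite: Chatterjee2019LargeN, §2.1 («The null loop sequence is defined to have length zero»)] -/
theorem len_nil : len ([] : LoopSeq d) = 0 := rfl

/-- `|(l, l₂, …, lₙ)| = |l| + |(l₂, …, lₙ)|`. [cite: Chatterjee2019LargeN, §2.1 (|s| = |l₁| + ⋯ + |lₙ|)] -/
theorem len_cons (l : Word d) (s : LoopSeq d) : len (l :: s) = l.length + len s := rfl

end LoopSeq

/-! ### §2.2: the string operations on (based) loops

Conventions for a word `l` of length `n` and locations `x ≠ y : Fin n`: rotate `l` so that the
letter `e` at location `x` comes first, `l ~r e b₁ a' c₁` where `a'` is the letter at location `y`,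
`b₁ = Word.arcBetween l x y` (the letters strictly between `x` and `y`, cyclically) and
`c₁ = Word.arcAfter l x y` (the letters strictly after `y`, cyclically, up to `x`). In the source's
notation `l = a e b e c` (or `a e b e⁻¹ c`) this is the cyclically equivalent choice `a = ∅`, which
the definitions of §2.2, being definitions on cycles, allow. -/

namespace Word

/-- The letter at location `x`. [cite: Chatterjee2019LargeN, §2.1 (edge at location k)] -/
def letter (l : Word d) (x : Fin l.length) : DEdge d := l.get x

/-- The cyclic gap from location `x` to location `y`: `(y - x) mod n ∈ {0, …, n-1}`.
[cite: Chatterjee2019LargeN, §2.1 (locations in a cycle)] -/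
def gap (l : Word d) (x y : Fin l.length) : ℕ := ((y - x : Fin l.length) : ℕ)

/-- The letters strictly between locations `x` and `y`, read cyclically from `x` (the `b` of
`l = a e b e' c`). [cite: Chatterjee2019LargeN, §2.2 (l = aebec)] -/
def arcBetween (l : Word d) (x y : Fin l.length) : Word d :=
  ((l.rotate x).drop 1).take (gap l x y - 1)

/-- The letters strictly after location `y` up to (excluding) location `x`, cyclically (the `c a`
of `l = a e b e' c`, rotated so that `a = ∅`). [cite: Chatterjee2019LargeN, §2.2 (l = aebec)] -/
def arcAfter (l : Word d) (x y : Fin l.length) : Word d :=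
  (l.rotate x).drop (gap l x y + 1)

/-- The tail of `l` read cyclically from just after location `x` back to `x` (the `b` of `l = a e b`
with `a = ∅`, resp. the `d` of `l' = c e d` with `c = ∅`). [cite: Chatterjee2019LargeN, §2.2 (l = aeb, l' = ced)] -/
def tailFrom (l : Word d) (x : Fin l.length) : Word d := (l.rotate x).drop 1

/-- **Positive splitting, first loop**: for `l = a e b e c` (the same edge `e` at `x` and `y`),
`×¹_{x,y} l = [a e c]`; with `a = ∅`: `[e c]`. [cite: Chatterjee2019LargeN, §2.2 (positive splitting ×¹)] -/
def posSplit₁ (l : Word d) (x y : Fin l.length) : Word d := core (l.letter x :: arcAfter l x y)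

/-- **Positive splitting, second loop**: `×²_{x,y} l = [b e]`. [cite: Chatterjee2019LargeN, §2.2 (positive splitting ×²)] -/
def posSplit₂ (l : Word d) (x y : Fin l.length) : Word d := core (arcBetween l x y ++ [l.letter x])

/-- **Negative splitting, first loop**: for `l = a e b e⁻¹ c` (`e` at `x`, `e⁻¹` at `y`),
`×¹_{x,y} l = [a c]`; with `a = ∅`: `[c]`. [cite: Chatterjee2019LargeN, §2.2 (negative splitting ×¹)] -/
def negSplit₁ (l : Word d) (x y : Fin l.length) : Word d := core (arcAfter l x y)

/-- **Negative splitting, second loop**: `×²_{x,y} l = [b]`. [cite: Chatterjee2019LargeN, §2.2 (negative splitting ×²)] -/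
def negSplit₂ (l : Word d) (x y : Fin l.length) : Word d := core (arcBetween l x y)

/-- **Negative twisting** (the same edge `e` at `x` and `y`, `l = a e b e c`):
`∝_{x,y} l = [a b⁻¹ c]`; with `a = ∅`: `[b⁻¹ c]`. [cite: Chatterjee2019LargeN, §2.2 (negative twisting)] -/
def negTwist (l : Word d) (x y : Fin l.length) : Word d :=
  core (FreeGroup.invRev (arcBetween l x y) ++ arcAfter l x y)

/-- **Positive twisting** (`e` at `x`, `e⁻¹` at `y`, `l = a e b e⁻¹ c`):
`∝_{x,y} l = [a e b⁻¹ e⁻¹ c]`; with `a = ∅`: `[e b⁻¹ e⁻¹ c]`. [cite: Chatterjee2019LargeN, §2.2 (positive twisting)] -/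
def posTwist (l : Word d) (x y : Fin l.length) : Word d :=
  core (l.letter x :: FreeGroup.invRev (arcBetween l x y) ++ DEdge.inv (l.letter x) :: arcAfter l x y)

/-- **Positive merger** on rotated operands: `L = e b` (the loop `l` rotated to location `x`) and
`M = a d` (the loop `l'` rotated to location `y`, `a ∈ {e, e⁻¹}`). If `a = e` (`l = aeb`,
`l' = ced`): `l ⊕ l' = [a e d c e b]`, here `[e d e b]`; if `a = e⁻¹` (`l' = c e⁻¹ d`):
`l ⊕ l' = [a e c⁻¹ d⁻¹ e b]`, here `[e d⁻¹ e b]`. Junk `[]` on empty operands.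
[cite: Chatterjee2019LargeN, §2.2 (positive merger l ⊕_{x,y} l', both cases)] -/
def posMergeRot : Word d → Word d → Word d
  | e :: b, a :: d' =>
      if a.2 = e.2 then core (e :: d' ++ e :: b) else core (e :: FreeGroup.invRev d' ++ e :: b)
  | _, _ => []

/-- **Negative merger** on rotated operands (notation of `posMergeRot`): if `a = e`,
`l ⊖ l' = [a c⁻¹ d⁻¹ b]`, here `[d⁻¹ b]`; if `a = e⁻¹`, `l ⊖ l' = [a d c b]`, here `[d b]`.
[cite: Chatterjee2019LargeN, §2.2 (negative merger l ⊖_{x,y} l', both cases)] -/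
def negMergeRot : Word d → Word d → Word d
  | e :: b, a :: d' => if a.2 = e.2 then core (FreeGroup.invRev d' ++ b) else core (d' ++ b)
  | _, _ => []

/-- The positive merger `l ⊕_{x,y} l'` of two loops at locations `x` of `l` and `y` of `l'`
carrying the same undirected edge. [cite: Chatterjee2019LargeN, §2.2 (positive merger)] -/
def posMerge (l : Word d) (x : Fin l.length) (m : Word d) (y : Fin m.length) : Word d :=
  posMergeRot (l.rotate x) (m.rotate y)

/-- The negative merger `l ⊖_{x,y} l'`. [cite: Chatterjee2019LargeN, §2.2 (negative merger)] -/
def negMerge (l : Word d) (x : Fin l.length) (m : Word d) (y : Fin m.length) : Word d :=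
  negMergeRot (l.rotate x) (m.rotate y)

/-- The location in the plaquette word of `p` of the letter carrying the undirected edge `e`
(junk `4 = length` if `p ∉ 𝒫⁺(e)`; «a plaquette cannot contain an edge `e` or its inverse at more
than one location»). [cite: Chatterjee2019LargeN, §2.2 (l ⊕ₓ p: the unique location y in p)] -/
def plaquetteLoc (p : ZdPlaquette d) (e : ZdEdge d) : ℕ :=
  (plaquetteWord p).findIdx fun a => a.1 = e

/-- **Positive deformation** `l ⊕ₓ p` of the loop `l` at location `x` by the plaquette
`p ∈ 𝒫⁺(e)`, `e` the edge at `x`: the positive merger of `l` with the plaquette loop `p` at the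
unique location of `e^{±1}` in `p`. [cite: Chatterjee2019LargeN, §2.2 (deformations l ⊕ₓ p)] -/
def posDeform (l : Word d) (x : Fin l.length) (p : ZdPlaquette d) : Word d :=
  posMergeRot (l.rotate x) ((plaquetteWord p).rotate (plaquetteLoc p (l.letter x).1))

/-- **Negative deformation** `l ⊖ₓ p`. [cite: Chatterjee2019LargeN, §2.2 (deformations l ⊖ₓ p)] -/
def negDeform (l : Word d) (x : Fin l.length) (p : ZdPlaquette d) : Word d :=
  negMergeRot (l.rotate x) ((plaquetteWord p).rotate (plaquetteLoc p (l.letter x).1))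

end Word

/-! ### §2.2: the operation sets `𝔻^±(s)`, `𝕊^±(s)`, `𝕋^±(s)`, `𝕄^±(s)` as finite index types

For a loop sequence `s = (l₁, …, lₙ)` (a list; component `i : Fin s.length`, `lᵢ = s.get i`) the
operations are indexed by their data; each index type is a finite type (a `Σ`/subtype of finite
types, so that `Fintype` is found by instance search) and comes with the map to the resulting
loop sequence (flag F3: counted with multiplicity). -/

/-- Index type of **deformations** of `s` (either sign): a component `i`, a location `x` in `lᵢ`,
and a plaquette `p ∈ 𝒫⁺(e)` through the edge `e` at `x`. [cite: Chatterjee2019LargeN, §2.2 (𝔻⁺(s), 𝔻⁻(s))] -/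
abbrev DeformIdx (s : LoopSeq d) : Type :=
  Σ i : Fin s.length, Σ x : Fin (s.get i).length, ↥(plaquettesAt ((s.get i).get x))

/-- Index type of the operations at two distinct locations `x ≠ y` of one component carrying THE
SAME directed edge: positive splittings `𝕊⁺(s)` and negative twistings `𝕋⁻(s)` (ordered pairs:
«these two splittings are identified as distinct elements of `𝕊⁺(s)`»).
[cite: Chatterjee2019LargeN, §2.2 (𝕊⁺(s), 𝕋⁻(s); counting)] -/
abbrev SameIdx (s : LoopSeq d) : Type :=
  Σ i : Fin s.length, {xy : Fin (s.get i).length × Fin (s.get i).length //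
    xy.1 ≠ xy.2 ∧ (s.get i).get xy.2 = (s.get i).get xy.1}

/-- Index type of the operations at two locations `x, y` of one component carrying INVERSE edges
(`e` at `x`, `e⁻¹` at `y`): negative splittings `𝕊⁻(s)` and positive twistings `𝕋⁺(s)`.
[cite: Chatterjee2019LargeN, §2.2 (𝕊⁻(s), 𝕋⁺(s); counting)] -/
abbrev InvIdx (s : LoopSeq d) : Type :=
  Σ i : Fin s.length, {xy : Fin (s.get i).length × Fin (s.get i).length //
    (s.get i).get xy.2 = DEdge.inv ((s.get i).get xy.1)}

/-- Index type of **mergers** of `s` (either sign): two distinct components `i ≠ j` (ordered) and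
locations `x` in `lᵢ`, `y` in `lⱼ` carrying the same undirected edge (`e` and `e` or `e` and `e⁻¹`).
[cite: Chatterjee2019LargeN, §2.2 (𝕄⁺(s), 𝕄⁻(s); counting of mergers)] -/
abbrev MergeIdx (s : LoopSeq d) : Type :=
  Σ i : Fin s.length, Σ j : Fin s.length, {xy : Fin (s.get i).length × Fin (s.get j).length //
    i ≠ j ∧ ((s.get j).get xy.2).1 = ((s.get i).get xy.1).1}

namespace LoopSeq

/-- The loop sequence produced by the positive deformation `o ∈ 𝔻⁺(s)`: `lᵢ` replaced by
`lᵢ ⊕ₓ p` (null result deleted). [cite: Chatterjee2019LargeN, §2.2 (s' a positive deformation of s)] -/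
def posDeformAt (s : LoopSeq d) (o : DeformIdx s) : LoopSeq d :=
  s.replaceAt o.1 [Word.posDeform (s.get o.1) o.2.1 o.2.2.1]

/-- The loop sequence produced by the negative deformation `o ∈ 𝔻⁻(s)`. [cite: Chatterjee2019LargeN, §2.2 (negative deformation of s)] -/
def negDeformAt (s : LoopSeq d) (o : DeformIdx s) : LoopSeq d :=
  s.replaceAt o.1 [Word.negDeform (s.get o.1) o.2.1 o.2.2.1]

/-- The loop sequence produced by the positive splitting `o ∈ 𝕊⁺(s)`: `lᵢ` replaced by the pair
`(×¹_{x,y} lᵢ, ×²_{x,y} lᵢ)` in this order (null results deleted). [cite: Chatterjee2019LargeN, §2.2 (s' a positive splitting of s)] -/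
def posSplitAt (s : LoopSeq d) (o : SameIdx s) : LoopSeq d :=
  s.replaceAt o.1
    [Word.posSplit₁ (s.get o.1) o.2.1.1 o.2.1.2, Word.posSplit₂ (s.get o.1) o.2.1.1 o.2.1.2]

/-- The loop sequence produced by the negative splitting `o ∈ 𝕊⁻(s)`. [cite: Chatterjee2019LargeN, §2.2 (negative splitting of s)] -/
def negSplitAt (s : LoopSeq d) (o : InvIdx s) : LoopSeq d :=
  s.replaceAt o.1
    [Word.negSplit₁ (s.get o.1) o.2.1.1 o.2.1.2, Word.negSplit₂ (s.get o.1) o.2.1.1 o.2.1.2]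

/-- The loop sequence produced by the negative twisting `o ∈ 𝕋⁻(s)` (same edge at `x, y`).
[cite: Chatterjee2019LargeN, §2.2 (negative twisting of s)] -/
def negTwistAt (s : LoopSeq d) (o : SameIdx s) : LoopSeq d :=
  s.replaceAt o.1 [Word.negTwist (s.get o.1) o.2.1.1 o.2.1.2]

/-- The loop sequence produced by the positive twisting `o ∈ 𝕋⁺(s)` (inverse edges at `x, y`).
[cite: Chatterjee2019LargeN, §2.2 (positive twisting of s)] -/
def posTwistAt (s : LoopSeq d) (o : InvIdx s) : LoopSeq d :=
  s.replaceAt o.1 [Word.posTwist (s.get o.1) o.2.1.1 o.2.1.2]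

/-- The loop sequence produced by the positive merger `o ∈ 𝕄⁺(s)` of `lᵢ` (at `x`) with `lⱼ` (at
`y`): `lᵢ` is replaced by `lᵢ ⊕_{x,y} lⱼ` and `lⱼ` is deleted (the merged loop sits at the position of
the FIRST operand, as in `(l₁ ⊕_{x,y} l_r, l₂, …, l_{r-1}, l_{r+1}, …, lₙ)`).
[cite: Chatterjee2019LargeN, §2.2 (s' a positive merger of s; counting of mergers)] -/
def posMergeAt (s : LoopSeq d) (o : MergeIdx s) : LoopSeq d :=
  prune ((s.set o.1 (Word.posMerge (s.get o.1) o.2.2.1.1 (s.get o.2.1) o.2.2.1.2)).eraseIdx o.2.1)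

/-- The loop sequence produced by the negative merger `o ∈ 𝕄⁻(s)`. [cite: Chatterjee2019LargeN, §2.2 (negative merger of s)] -/
def negMergeAt (s : LoopSeq d) (o : MergeIdx s) : LoopSeq d :=
  prune ((s.set o.1 (Word.negMerge (s.get o.1) o.2.2.1.1 (s.get o.2.1) o.2.2.1.2)).eraseIdx o.2.1)

end LoopSeq

/-! ### §2.2: trajectories and weights -/

/-- The elementary **moves** of a trajectory out of the loop sequence `s`: «each `sᵢ₊₁` is either a
deformation or a splitting of `sᵢ`. Note that mergers and twistings are not allowed.»
[cite: Chatterjee2019LargeN, §2.2 (definition of a trajectory)] -/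
inductive Move (s : LoopSeq d) : Type
  /-- a positive deformation `s' ∈ 𝔻⁺(s)` -/
  | posDeform (o : DeformIdx s)
  /-- a negative deformation `s' ∈ 𝔻⁻(s)` -/
  | negDeform (o : DeformIdx s)
  /-- a positive splitting `s' ∈ 𝕊⁺(s)` -/
  | posSplit (o : SameIdx s)
  /-- a negative splitting `s' ∈ 𝕊⁻(s)` -/
  | negSplit (o : InvIdx s)

namespace Move

variable {s : LoopSeq d}

/-- The loop sequence reached by a move. [cite: Chatterjee2019LargeN, §2.2 (trajectories)] -/
def result : Move s → LoopSeq d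
  | posDeform o => s.posDeformAt o
  | negDeform o => s.negDeformAt o
  | posSplit o => s.posSplitAt o
  | negSplit o => s.negSplitAt o

/-- The **weight** `w_β(s, s')` of a move at inverse coupling `β`: `-β/|s|` for a positive
deformation, `β/|s|` for a negative one, `-1/|s|` for a positive splitting, `1/|s|` for a negative
one. [cite: Chatterjee2019LargeN, §2.2 (definition of w_β(s, s'))] -/
def weight (β : ℝ) : Move s → ℝ
  | posDeform _ => -β / s.len
  | negDeform _ => β / s.len
  | posSplit _ => -1 / s.len
  | negSplit _ => 1 / s.len

/-- The **`β`-free weight** `v(s, s') = β⁻¹ w_β(s, s')` for deformations, `= w_β(s, s')` for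
splittings, i.e. `∓1/|s|`. [cite: Chatterjee2019LargeN, §2.2 (β-free weights v(s, s'))] -/
def vweight : Move s → ℝ
  | posDeform _ => -1 / s.len
  | negDeform _ => 1 / s.len
  | posSplit _ => -1 / s.len
  | negSplit _ => 1 / s.len

/-- Whether a move is a deformation step (counted by `δ(X)`). [cite: Chatterjee2019LargeN, §2.2 (δ(X))] -/
def isDeform : Move s → Bool
  | posDeform _ => true
  | negDeform _ => true
  | posSplit _ => false
  | negSplit _ => false

end Move

/-- **Vanishing trajectories** `𝒳(s)`: finite sequences `(s₀, s₁, …, sₙ)` with `s₀ = s`, each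
`sᵢ₊₁` a deformation or splitting of `sᵢ` (as a `Move sᵢ`, i.e. with multiplicity, flag F3) and
`sₙ` the null loop sequence. `Trajectory s` IS the set `𝒳(s)`; the trivial trajectory `(∅)` is
`Trajectory.nil`. [cite: Chatterjee2019LargeN, §2.2 (trajectories, vanishing trajectories 𝒳(s))] -/
inductive Trajectory : LoopSeq d → Type
  /-- the one-element trajectory `(∅)` of the null loop sequence -/
  | nil : Trajectory []
  /-- prepend the move `m : s ↝ m.result` to a vanishing trajectory of `m.result` -/
  | cons {s : LoopSeq d} (m : Move s) (X : Trajectory m.result) : Trajectory s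

namespace Trajectory

/-- The **weight** `w_β(X) = w_β(s₀, s₁) w_β(s₁, s₂) ⋯ w_β(sₙ₋₁, sₙ)` of a vanishing trajectory
(empty product `1` for `(∅)`). [cite: Chatterjee2019LargeN, §2.2 (weight of a trajectory)] -/
def weight (β : ℝ) : {s : LoopSeq d} → Trajectory s → ℝ
  | _, nil => 1
  | _, cons m X => m.weight β * X.weight β

/-- The `β`-free weight `v(X) = v(s₀, s₁) ⋯ v(sₙ₋₁, sₙ)`. [cite: Chatterjee2019LargeN, §2.2 (β-free weight of a trajectory)] -/
def vweight : {s : LoopSeq d} → Trajectory s → ℝ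
  | _, nil => 1
  | _, cons m X => m.vweight * X.vweight

/-- The number `δ(X)` of deformation steps of `X` (`w_β(X) = v(X) β^{δ(X)}`).
[cite: Chatterjee2019LargeN, §2.2 (δ(X))] -/
def numDeform : {s : LoopSeq d} → Trajectory s → ℕ
  | _, nil => 0
  | _, cons m X => (if m.isDeform then 1 else 0) + X.numDeform

/-- The number of steps of a trajectory. [cite: Chatterjee2019LargeN, §2.2 (trajectories)] -/
def steps : {s : LoopSeq d} → Trajectory s → ℕ
  | _, nil => 0
  | _, cons _ X => X.steps + 1

/-- `w_β(X) = v(X) β^{δ(X)}` («`w_β(X)` and `v(X)` are related by the relation …»).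
[cite: Chatterjee2019LargeN, §2.2 (last sentence)] -/
theorem weight_eq_vweight_mul_pow (β : ℝ) : ∀ {s : LoopSeq d} (X : Trajectory s),
    X.weight β = X.vweight * β ^ X.numDeform
  | _, nil => by simp [weight, vweight, numDeform]
  | _, cons m X => by
    rw [weight, vweight, numDeform, weight_eq_vweight_mul_pow β X, pow_add]
    cases m <;> simp [Move.weight, Move.vweight, Move.isDeform] <;> ring

end Trajectory

/-- `𝒳ₖ(s)`: the vanishing trajectories from `s` with exactly `k` deformation steps.
[cite: Chatterjee2019LargeN, §2.2 (𝒳ₖ(s))] -/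
abbrev TrajectoryWith (s : LoopSeq d) (k : ℕ) : Type := {X : Trajectory s // X.numDeform = k}

end Literature.MathematicalPhysics.QuantumFieldTheory.Chatterjee2019LargeN

end
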